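import Literature.Dynamics.NBody.AlbouyKaloshin2012SliceBranches

/-!
# Positive solutions of the `T12` slice live in two branch classes

Companion of `AlbouyKaloshin2012SliceBranches.lean`.  If the four inverse distances `u = δ₁₂`,
`d₃₄, d₃₅, d₄₅` of a `T12` solution are POSITIVE (as they are for a positive normalized central
configuration, Definition 1 of [AlbouyKaloshin2012], where every `δ_kl = 1/r_kl > 0`), then the branch
signs `σ₃₄, σ₃₅, σ₄₅` are the signs of `y₄−y₃, y₅−y₃, y₅−y₄`, i.e. they record the ORDER of the three
collinear bodies, and an order never produces the patterns `(1,−1,1)` or `(−1,1,−1)`.  Those two patterns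
form exactly the third branch class of `t12SliceSet_finite_iff_three` — the class containing the signed
Roberts continuum (`t12Branch_roberts`: there `δ₃₅, δ₄₅ < 0`).  Consequently
(`t12PosSet_finite_of_two`): the positive-`δ` solutions of `T12(b,c)` are finite as soon as the TWO
branch systems `σ = (1,1,1,1)` ("body 5 at an end") and `σ = (1,1,1,−1)` ("body 5 in the middle") have
finitely many solutions — the branch class that carries the known complex/signed obstruction at
`(1,1,1,1,1/4)` is irrelevant for positive central configurations of this symmetry type.  This is the
statement the cell's branch computations at `(b,c) = (1, 1/4)` address (jobs `…:br=++++`, `…:br=+++-`).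
Elementary real algebra only.
-/

namespace Literature.Dynamics.NBody

/-- Solutions of `T12Slice b c` whose inverse distances `u, d₃₄, d₃₅, d₄₅` are positive. [folklore] -/
def t12PosSet (b c : ℝ) : Set T12Pt :=
  {X | X.Slice b c ∧ 0 < X.u ∧ 0 < X.d₃₄ ∧ 0 < X.d₃₅ ∧ 0 < X.d₄₅}

/-- With positive `d₃₄, d₃₅, d₄₅` the branch signs come from an order of `y₃, y₄, y₅`: the pattern
`(σ₃₄,σ₃₅,σ₄₅) = (1,−1,1)` is impossible. [folklore] -/
theorem T12Branch.not_pattern_pmp {σ₁₂ b c : ℝ} {X : T12Pt} (h : T12Branch σ₁₂ 1 (-1) 1 b c X)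
    (h34 : 0 < X.d₃₄) (h35 : 0 < X.d₃₅) (h45 : 0 < X.d₄₅) : False := by
  obtain ⟨-, -, -, -, -, -, -, -, -, e34, e35, e45⟩ := h
  have p1 : 0 < X.y₄ - X.y₃ := pos_of_mul_pos_right (by rw [e34]; norm_num) h34.le
  have p2 : X.y₅ - X.y₃ < 0 := neg_of_mul_neg_right (by rw [e35]; norm_num) h35.le
  have p3 : 0 < X.y₅ - X.y₄ := pos_of_mul_pos_right (by rw [e45]; norm_num) h45.le
  linarith

/-- … and so is `(σ₃₄,σ₃₅,σ₄₅) = (−1,1,−1)`. [folklore] -/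
theorem T12Branch.not_pattern_mpm {σ₁₂ b c : ℝ} {X : T12Pt} (h : T12Branch σ₁₂ (-1) 1 (-1) b c X)
    (h34 : 0 < X.d₃₄) (h35 : 0 < X.d₃₅) (h45 : 0 < X.d₄₅) : False := by
  obtain ⟨-, -, -, -, -, -, -, -, -, e34, e35, e45⟩ := h
  have p1 : X.y₄ - X.y₃ < 0 := neg_of_mul_neg_right (by rw [e34]; norm_num) h34.le
  have p2 : 0 < X.y₅ - X.y₃ := pos_of_mul_pos_right (by rw [e35]; norm_num) h35.le
  have p3 : X.y₅ - X.y₄ < 0 := neg_of_mul_neg_right (by rw [e45]; norm_num) h45.le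
  linarith

/-- **Two branches decide finiteness of the positive `T12` solutions.** If the branch systems
`σ = (1,1,1,1)` and `σ = (1,1,1,−1)` of `T12Slice b c` have finitely many real solutions, then so does the
set of solutions with `u, d₃₄, d₃₅, d₄₅ > 0` (in particular the `T12`-symmetric positive normalized
central configurations with masses `(1,1,b,b,c)`); the third class of `t12SliceSet_finite_iff_three` is
not needed. [folklore] -/
theorem t12PosSet_finite_of_two (b c : ℝ) (hA : (t12BranchSet 1 1 1 1 b c).Finite)
    (hB : (t12BranchSet 1 1 1 (-1) b c).Finite) : (t12PosSet b c).Finite := by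
  have hD := t12BranchSet_finite_reflect hA
  have hG := t12BranchSet_finite_swap34 hA
  have hH := t12BranchSet_finite_reflect hG
  have hE := t12BranchSet_finite_reflect hB
  norm_num at hD hG hH hE
  have nA := t12BranchSet_finite_negS hA; have nB := t12BranchSet_finite_negS hB
  have nD := t12BranchSet_finite_negS hD; have nG := t12BranchSet_finite_negS hG
  have nH := t12BranchSet_finite_negS hH; have nE := t12BranchSet_finite_negS hE
  refine ((((hA.union hB).union (hD.union hG)).union (hH.union hE)).union
    (((nA.union nB).union (nD.union nG)).union (nH.union nE))).subset ?_
  rintro X ⟨hX, -, h34, h35, h45⟩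
  obtain ⟨σ₁₂, σ₃₄, σ₃₅, σ₄₅, s12, s34, s35, s45, hBr⟩ := (t12Slice_iff_exists_branch b c X).1 hX
  simp only [Set.mem_union, t12BranchSet, Set.mem_setOf_eq]
  rcases s12 with rfl | rfl <;> rcases s34 with rfl | rfl <;> rcases s35 with rfl | rfl <;>
    rcases s45 with rfl | rfl
  all_goals first
    | exact (T12Branch.not_pattern_pmp hBr h34 h35 h45).elim
    | exact (T12Branch.not_pattern_mpm hBr h34 h35 h45).elim
    | tauto

end Literature.Dynamics.NBody
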